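import Summits.QuantumFields.YangMills.Theorems.UnitScaleTiltProp7LocalHessianComparison
import Summits.QuantumFields.YangMills.Theorems.UnitScaleTiltProp7TwoBackgroundCurlComparison
import HarnessLib

/-!
# Route `UnitScaleTilt`, crux K1 «MinimiserStabilityRegPr» (stmt-QuantumFields-19200), EX row `hGF` (curved member) — small members, exit (α)(b)
# «member ↦ nearest toron»: **THE TWO-BACKGROUND EDITION OF THE (L5a) HESSIAN COMPARISON ROW** —
# `|re⟪X̃, Δ^η(U₀)X̃⟫ − re⟪Ỹ, Δ^η(W)Ỹ⟫| ≤ θ·re⟪Ỹ, Δ^η(W)Ỹ⟫ + (1 + θ⁻¹)·16·(η⁻¹δ)²·‖X̃‖² + (2 + θ)·1029ε₀·‖X̃‖²`, `Y = Ad_σX`, for TWO backgrounds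
# `U₀, W ∈ RegPr F n K ε₀` with `U₀^σ` `δ`-close to `W` on the plaquette edges adjacent to `supp X` (✓`Prop7LocalHessianComparison` is the case `W = 1`, where `P_1 = 0`)

Cell `ym3-torus` (HUMAN RULING D-0037: YM₃ on T³ is ladder rung R3 — NOT d = 4, NOT infinite volume, NOT a mass gap, NOT Clay).  Width seat `ym-ust-19200-w5` (gen 14);
offered 2026-08-30 03:17Z as the `Δ^η` third of the (α)(b) comparison rows (★★OWNER WORDS 79∕82: small-member exit (α)(a) + (α)(b); px10 g10 `LOCATE-SMALL-MEMBERS` §(iv)).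
THEOREMS ONLY (0 `def`, 0 `sorry`); `--supports stmt-QuantumFields-19200 --as helper`, count-neutral.  HONEST LABEL: a supplier row; nothing of the twisted coercivity (α)(a),
the toron gauge (P3), `hT`, `hGF`, (3.49), EX or the crux is proved here.

THE MATHEMATICS ([Balaban1985BackgroundPropagators] (3.4) p. 391, (3.10)–(3.12) p. 392, covariance p. 393, (3.69) p. 404).
* TWO-BACKGROUND CLOSENESS (companion file).  `((D¹_V − D¹_W)Y)(p_{μν}(x)) = (V(x,μ)ZV(x,μ)* − W(x,μ)ZW(x,μ)*) − (μ ↔ ν)`, `Z = Y_ν(x + e_μ)`: ZEROTH order in `Y`, and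
  `VZV* − WZW* = (V − W)·ZV* + WZ·(V − W)*` gives `‖VZV* − WZW*‖_F² ≤ 4‖V − W‖²‖Z‖_F²`; the plaquette∕bond count of w7 g11's ✓`curlSq_sub_le` then yields
  `Σ_{posPlaq}‖(D¹_V − D¹_W)Y‖_F² ≤ 16δ²Σ_b‖Y_b‖_F²` whenever `‖V(x,μ) − W(x,μ)‖ ≤ δ` on the edges adjacent to `supp Y`.
* THE ROWS.  Both Hessians are read through the SAME dictionary ✓`re_inner_DeltaEta_toL2_eq_curlSq_add`: `re⟪X̃, Δ^η(U)X̃⟫ = c₀η⁻²(CURL_U(X) + P_U(X))` with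
  `|P_U(X)| ≤ 1029ε₀η²Σ_b‖X_b‖_F²` for EVERY `U ∈ RegPr F n K ε₀` (✓`abs_curvPart_le`) — so no flat formula is needed for `W`: BOTH curvature parts are paid (`2·1029ε₀`), the main
  terms are compared by the squares row after the exact covariance `CURL_{U₀}(X) = CURL_{U₀^σ}(Ad_σX)` (✓`curlSq_gaugeAct_conj_eq`), and `θ·c₀η⁻²CURL_W(Y) ≤ θ·(re⟪Ỹ, Δ^η(W)Ỹ⟫ +
  1029ε₀‖X̃‖²)` accounts for the last `θ·1029ε₀`.
WHY THE GENERALITY MATTERS (the η-count).  The error is `(η⁻¹δ)²`: K-uniform exactly when `σ` brings `U₀` within `δ ≲ C·η` of `W` bondwise.  At a small member (`2L^{m+n} < 2R′`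
coarse sites: no cube partition, px17 ✓`exists_sqPartition` needs `s < m + n`) the comparison background is a TORON `W` (constant abelian, `W ∈ RegPr F n K ε₀` for every `ε₀ > 0`
since its plaquettes are `1` and its divergence `0`), and the toron gauge must be η-relative on EVERY bond, wrap bonds included.

WHAT IS PROVED (ns `…Theorems.Prop7TwoBackgroundHessianComparison`; the letters — ★`sum_normSq_conjAd_sub_conjAd_le`, `curl_sub_curl_apply`, ★★`curlSq_sub_curlSq_le` — are the
companion file `Prop7TwoBackgroundCurlComparison`): ★★★`abs_re_inner_DeltaEta_sub_conj_le` (main term at `W`), ★★★`abs_re_inner_DeltaEta_sub_conj_le'` (main term at `U₀`),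
and the support-free corollary `…_conj_le_of_forall` (one gauge, every bond — the small-member shape).
HONEST SCOPE.  Stencil algebra and Frobenius bookkeeping over landed dictionaries; the closeness `hVW` is a HYPOTHESIS (its inhabitant at a small member is P3's η-relative toron gauge).

References: T. Bałaban, CMP **99** (1985) 389–434 [Balaban1985BackgroundPropagators] ((3.3)–(3.5) p.391, (3.10)–(3.12) p.392, p.393, (3.69) p.404); CMP **99** (1985) 75–102
[Balaban1985RegularSpaces] (Lemma 1 (1.25) p.79); CMP **98** (1985) 17–51 [Balaban1985Averaging] ((18)–(20) p.21).
-/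

set_option autoImplicit false

noncomputable section

open scoped Matrix.Norms.L2Operator BigOperators Matrix InnerProductSpace ComplexConjugate

namespace Summit.QuantumFields.YangMills.Theorems.Prop7TwoBackgroundHessianComparison

open Literature.MathematicalPhysics.QuantumFieldTheory.Balaban1983to89
open Literature.MathematicalPhysics.QuantumFieldTheory.Balaban1983to89.T3ContinuumYM3Torus
open Literature.MathematicalPhysics.QuantumFieldTheory.Balaban1983to89.T3PrintedRegularMinimiser (RegPr)
open T3SectALandauChart (formComp bgUnits eta eta_pos)
open B9Eq39Adjoint (curl posPlaq)
open B9Eq310Hermitian (deltaPrimeOp)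
open B9TorusCalculus (torusT)
open Summit.QuantumFields.YangMills.Theorems.Prop7SectET3HilbertLetters (W₂ frobEquiv toL2)
open Summit.QuantumFields.YangMills.Theorems.Prop7SectET3WilsonHessian (DeltaEta)
open Summit.QuantumFields.YangMills.Theorems.Prop7DeltaEtaAlmostPositive (norm_toL2_sq)
open Summit.QuantumFields.YangMills.Theorems.Prop7LocalDivergenceComparison (sum_normSq_conj_eq norm_toL2_conj_eq)
open Summit.QuantumFields.YangMills.Theorems.Prop7LocalHessianComparison (abs_sum_sq_sub_sum_sq_le)
open Summit.QuantumFields.YangMills.Theorems.Prop7CovariantCurlGaugeComparison (curlSq_gaugeAct_conj_eq re_inner_DeltaEta_toL2_eq_curlSq_add abs_curvPart_le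
  sum_norm_sq_frobEquiv_symm_eq)
open Summit.QuantumFields.YangMills.Theorems.Prop7TwoBackgroundCurlComparison (curlSq_sub_curlSq_le)

/-! ## ★★★ The two-background (L5a) rows -/

section Row

variable (F : T3Family) (n K : ℕ) (c₀ : ℝ) [Fact (0 < c₀)]

/-- ★★★ **THE TWO-BACKGROUND (L5a) ROW, MAIN TERM AT `W`.**  For backgrounds `U₀, W` on `RegPr F n K ε₀`, a gauge transformation `σ` whose gauged background `U₀^σ = GaugeField.gaugeAct σ U₀`
satisfies `‖U₀^σ(x,μ) − W(x,μ)‖ ≤ δ` on every edge `⟨x, μ⟩` ADJACENT to the support of `X` (whenever `X(x + e_μ, ν) ≠ 0` for some `ν ≠ μ`), the conjugated one-form `Y = Ad_σX`,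
`Y(b) = σ(b₋)X(b)σ(b₋)*`, and any `θ > 0`:
`|re⟪X̃, Δ^η(U₀)X̃⟫ − re⟪Ỹ, Δ^η(W)Ỹ⟫| ≤ θ·re⟪Ỹ, Δ^η(W)Ỹ⟫ + (1 + θ⁻¹)·(16·η⁻²·δ²)·‖X̃‖² + (2 + θ)·1029·ε₀·‖X̃‖²`.
At `W = 1` (where `P_1 = 0` saves `(1 + θ)·1029ε₀`) this is w7 g11's ✓`Prop7LocalHessianComparison.abs_re_inner_DeltaEta_sub_flat_conj_le`; at a small member `W` is the nearest toron.
[cite: Balaban1985BackgroundPropagators, (3.4) p.391, (3.10)–(3.12) p.392, p.393, (3.69) p.404; Balaban1985RegularSpaces, Lemma 1 (1.25) p.79] -/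
theorem abs_re_inner_DeltaEta_sub_conj_le {ε₀ : ℝ} (hε₀ : 0 ≤ ε₀) (σ : GaugeTransf (F.P K) 0 (Matrix.specialUnitaryGroup (Fin 2) ℂ))
    (U₀ W : GaugeField (F.P K) 0 (Matrix.specialUnitaryGroup (Fin 2) ℂ)) (hregU : RegPr F n K ε₀ U₀) (hregW : RegPr F n K ε₀ W)
    (X : PBond (F.P K) 0 → Matrix (Fin 2) (Fin 2) ℂ) {δ θ : ℝ} (hθ : 0 < θ)
    (hVW : ∀ (x : Site (F.P K) 0) (μ ν : Fin (F.P K).d), μ ≠ ν → X ⟨x.shift μ, ν⟩ ≠ 0 →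
      ‖((GaugeField.gaugeAct σ U₀ ⟨x, μ⟩ : Matrix.specialUnitaryGroup (Fin 2) ℂ) : Matrix (Fin 2) (Fin 2) ℂ) - (W ⟨x, μ⟩ : Matrix (Fin 2) (Fin 2) ℂ)‖ ≤ δ) :
    |RCLike.re ⟪toL2 F K c₀ X, DeltaEta F n K c₀ U₀ (toL2 F K c₀ X)⟫_ℂ
        - RCLike.re ⟪toL2 F K c₀ (fun b => (σ b.src : Matrix (Fin 2) (Fin 2) ℂ) * X b * star (σ b.src : Matrix (Fin 2) (Fin 2) ℂ)),
            DeltaEta F n K c₀ W (toL2 F K c₀ (fun b => (σ b.src : Matrix (Fin 2) (Fin 2) ℂ) * X b * star (σ b.src : Matrix (Fin 2) (Fin 2) ℂ)))⟫_ℂ|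
      ≤ θ * RCLike.re ⟪toL2 F K c₀ (fun b => (σ b.src : Matrix (Fin 2) (Fin 2) ℂ) * X b * star (σ b.src : Matrix (Fin 2) (Fin 2) ℂ)),
            DeltaEta F n K c₀ W (toL2 F K c₀ (fun b => (σ b.src : Matrix (Fin 2) (Fin 2) ℂ) * X b * star (σ b.src : Matrix (Fin 2) (Fin 2) ℂ)))⟫_ℂ
        + (1 + θ⁻¹) * (16 * ((eta F n K)⁻¹) ^ 2 * δ ^ 2) * ‖toL2 F K c₀ X‖ ^ 2 + (2 + θ) * (1029 * ε₀) * ‖toL2 F K c₀ X‖ ^ 2 := by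
  have hc₀ : 0 < c₀ := Fact.out
  have hη : 0 < eta F n K := eta_pos F n K
  have hk : 0 ≤ c₀ * (eta F n K)⁻¹ ^ 2 := by positivity
  set Y : PBond (F.P K) 0 → Matrix (Fin 2) (Fin 2) ℂ := fun b => (σ b.src : Matrix (Fin 2) (Fin 2) ℂ) * X b * star (σ b.src : Matrix (Fin 2) (Fin 2) ℂ) with hY
  set V : GaugeField (F.P K) 0 (Matrix.specialUnitaryGroup (Fin 2) ℂ) := GaugeField.gaugeAct σ U₀ with hVdef
  set u : Site (F.P K) 0 × Fin (F.P K).d × Fin (F.P K).d → W₂ := fun q =>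
      frobEquiv.symm (curl (torusT (F.P K) 0) (fun μ x => bgUnits F K V ⟨x, μ⟩) (formComp Y) q.2.1 q.2.2 q.1) with hu
  set w : Site (F.P K) 0 × Fin (F.P K).d × Fin (F.P K).d → W₂ := fun q =>
      frobEquiv.symm (curl (torusT (F.P K) 0) (fun μ x => bgUnits F K W ⟨x, μ⟩) (formComp Y) q.2.1 q.2.2 q.1) with hw
  set PU : ℝ := (∑ b : PBond (F.P K) 0, Matrix.trace ((X b).conjTranspose
        * deltaPrimeOp (torusT (F.P K) 0) (fun μ x => bgUnits F K U₀ ⟨x, μ⟩) 1 (formComp X) b.dir b.src)).re with hPU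
  set PW : ℝ := (∑ b : PBond (F.P K) 0, Matrix.trace ((Y b).conjTranspose
        * deltaPrimeOp (torusT (F.P K) 0) (fun μ x => bgUnits F K W ⟨x, μ⟩) 1 (formComp Y) b.dir b.src)).re with hPW
  set SX : ℝ := ∑ b : PBond (F.P K) 0, ‖(frobEquiv.symm (X b) : W₂)‖ ^ 2 with hSX
  -- the two Hessians in real letters (same dictionary on both sides), covariance on the `U₀` side
  have hL : RCLike.re ⟪toL2 F K c₀ X, DeltaEta F n K c₀ U₀ (toL2 F K c₀ X)⟫_ℂ
      = c₀ * (eta F n K)⁻¹ ^ 2 * ((∑ q ∈ posPlaq (Site (F.P K) 0) (Fin (F.P K).d), ‖u q‖ ^ 2) + PU) := by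
    rw [re_inner_DeltaEta_toL2_eq_curlSq_add U₀ X, ← curlSq_gaugeAct_conj_eq σ U₀ X]
  have hR : RCLike.re ⟪toL2 F K c₀ Y, DeltaEta F n K c₀ W (toL2 F K c₀ Y)⟫_ℂ
      = c₀ * (eta F n K)⁻¹ ^ 2 * ((∑ q ∈ posPlaq (Site (F.P K) 0) (Fin (F.P K).d), ‖w q‖ ^ 2) + PW) :=
    re_inner_DeltaEta_toL2_eq_curlSq_add W Y
  -- `Σ_b ‖Y_b‖² = Σ_b ‖X_b‖²`
  have hSY : ∑ b : PBond (F.P K) 0, ‖(frobEquiv.symm (Y b) : W₂)‖ ^ 2 = SX := by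
    rw [hSX, sum_norm_sq_frobEquiv_symm_eq, sum_norm_sq_frobEquiv_symm_eq]
    exact Finset.sum_congr rfl fun b _ => sum_normSq_conj_eq (σ b.src) (X b)
  -- closeness on the adjacent-edge row (transported to `Y`: `supp Y = supp X`)
  have hVY : ∀ (x : Site (F.P K) 0) (μ ν : Fin (F.P K).d), μ ≠ ν → Y ⟨x.shift μ, ν⟩ ≠ 0 →
      ‖(V ⟨x, μ⟩ : Matrix (Fin 2) (Fin 2) ℂ) - (W ⟨x, μ⟩ : Matrix (Fin 2) (Fin 2) ℂ)‖ ≤ δ := by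
    intro x μ ν hμν hYb
    refine hVW x μ ν hμν fun h0 => hYb ?_
    simp [hY, h0]
  have hclose : ∑ q ∈ posPlaq (Site (F.P K) 0) (Fin (F.P K).d), ‖u q - w q‖ ^ 2 ≤ 16 * δ ^ 2 * SX := by
    have h1 := curlSq_sub_curlSq_le V W Y hVY
    have h2 : ∑ b : PBond (F.P K) 0, ∑ j, ∑ k, ‖Y b j k‖ ^ 2 = SX := by
      rw [← sum_norm_sq_frobEquiv_symm_eq, hSY]
    rw [h2] at h1
    refine le_of_eq_of_le (Finset.sum_congr rfl fun q _ => ?_) h1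
    rw [hu, hw, ← map_sub]
  -- the two curvature parts
  have hPU' : |PU| ≤ 1029 * (ε₀ * eta F n K ^ 2) * SX := abs_curvPart_le hε₀ U₀ hregU X
  have hPW' : |PW| ≤ 1029 * (ε₀ * eta F n K ^ 2) * SX := by
    have h := abs_curvPart_le hε₀ W hregW Y
    rwa [hSY] at h
  -- the norm of `X̃`
  have hnorm : ‖toL2 F K c₀ X‖ ^ 2 = c₀ * SX := norm_toL2_sq X
  -- squares row summed, main term on the SECOND (`W`) family
  have hsq := abs_sum_sq_sub_sum_sq_le (posPlaq (Site (F.P K) 0) (Fin (F.P K).d)) u w hθ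
  have hθ' : 0 ≤ 1 + θ⁻¹ := by positivity
  have hSX0 : 0 ≤ SX := Finset.sum_nonneg fun b _ => sq_nonneg _
  have hw0 : 0 ≤ ∑ q ∈ posPlaq (Site (F.P K) 0) (Fin (F.P K).d), ‖w q‖ ^ 2 := Finset.sum_nonneg fun q _ => sq_nonneg _
  have hηη : (eta F n K)⁻¹ ^ 2 * eta F n K ^ 2 = 1 := by rw [← mul_pow, inv_mul_cancel₀ hη.ne', one_pow]
  rw [hL, hR, hnorm]
  -- abbreviate the real numbers
  set CU : ℝ := ∑ q ∈ posPlaq (Site (F.P K) 0) (Fin (F.P K).d), ‖u q‖ ^ 2 with hCU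
  set CW : ℝ := ∑ q ∈ posPlaq (Site (F.P K) 0) (Fin (F.P K).d), ‖w q‖ ^ 2 with hCW
  set k : ℝ := c₀ * (eta F n K)⁻¹ ^ 2 with hkdef
  have hmain : |CU - CW| ≤ θ * CW + (1 + θ⁻¹) * (16 * δ ^ 2 * SX) :=
    hsq.trans (add_le_add_right (mul_le_mul_of_nonneg_left hclose hθ') _)
  have hPUk : k * |PU| ≤ 1029 * ε₀ * (c₀ * SX) := by
    calc k * |PU| ≤ k * (1029 * (ε₀ * eta F n K ^ 2) * SX) := mul_le_mul_of_nonneg_left hPU' hk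
      _ = 1029 * ε₀ * (c₀ * SX) * ((eta F n K)⁻¹ ^ 2 * eta F n K ^ 2) := by rw [hkdef]; ring
      _ = 1029 * ε₀ * (c₀ * SX) := by rw [hηη, mul_one]
  have hPWk : k * |PW| ≤ 1029 * ε₀ * (c₀ * SX) := by
    calc k * |PW| ≤ k * (1029 * (ε₀ * eta F n K ^ 2) * SX) := mul_le_mul_of_nonneg_left hPW' hk
      _ = 1029 * ε₀ * (c₀ * SX) * ((eta F n K)⁻¹ ^ 2 * eta F n K ^ 2) := by rw [hkdef]; ring
      _ = 1029 * ε₀ * (c₀ * SX) := by rw [hηη, mul_one]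
  have hkδ : k * ((1 + θ⁻¹) * (16 * δ ^ 2 * SX)) = (1 + θ⁻¹) * (16 * (eta F n K)⁻¹ ^ 2 * δ ^ 2) * (c₀ * SX) := by rw [hkdef]; ring
  -- `θ·k·CW ≤ θ·(k(CW + PW) + k|PW|)`
  have hCWle : k * CW ≤ k * (CW + PW) + k * |PW| := by
    have : -PW ≤ |PW| := neg_le_abs PW
    nlinarith [hk, this]
  calc |k * (CU + PU) - k * (CW + PW)|
        = k * |(CU - CW) + (PU - PW)| := by
          rw [← abs_of_nonneg hk, ← abs_mul, abs_of_nonneg hk]; ring_nf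
    _ ≤ k * (|CU - CW| + (|PU| + |PW|)) := by
          refine mul_le_mul_of_nonneg_left ((abs_add_le _ _).trans (add_le_add_right (abs_sub _ _) _)) hk
    _ ≤ k * ((θ * CW + (1 + θ⁻¹) * (16 * δ ^ 2 * SX)) + (|PU| + |PW|)) := by
          exact mul_le_mul_of_nonneg_left (add_le_add_left hmain _) hk
    _ = θ * (k * CW) + k * ((1 + θ⁻¹) * (16 * δ ^ 2 * SX)) + k * |PU| + k * |PW| := by ring
    _ ≤ θ * (k * (CW + PW) + k * |PW|) + (1 + θ⁻¹) * (16 * (eta F n K)⁻¹ ^ 2 * δ ^ 2) * (c₀ * SX)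
          + 1029 * ε₀ * (c₀ * SX) + 1029 * ε₀ * (c₀ * SX) := by
          rw [hkδ]
          have := mul_le_mul_of_nonneg_left hCWle hθ.le
          linarith
    _ ≤ θ * (k * (CW + PW)) + θ * (1029 * ε₀ * (c₀ * SX)) + (1 + θ⁻¹) * (16 * (eta F n K)⁻¹ ^ 2 * δ ^ 2) * (c₀ * SX)
          + 1029 * ε₀ * (c₀ * SX) + 1029 * ε₀ * (c₀ * SX) := by
          have := mul_le_mul_of_nonneg_left hPWk hθ.le
          linarith
    _ = θ * (k * (CW + PW)) + (1 + θ⁻¹) * (16 * (eta F n K)⁻¹ ^ 2 * δ ^ 2) * (c₀ * SX) + (2 + θ) * (1029 * ε₀) * (c₀ * SX) := by ring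

/-- ★★★ **THE TWO-BACKGROUND (L5a) ROW, MAIN TERM AT `U₀`** (the assembler's alternative, as in ✓`abs_re_inner_DeltaEta_sub_flat_conj_le'`): same hypotheses,
`|re⟪X̃, Δ^η(U₀)X̃⟫ − re⟪Ỹ, Δ^η(W)Ỹ⟫| ≤ θ·re⟪X̃, Δ^η(U₀)X̃⟫ + (1 + θ⁻¹)·(16·η⁻²·δ²)·‖X̃‖² + (2 + θ)·1029·ε₀·‖X̃‖²`.
[cite: Balaban1985BackgroundPropagators, (3.4) p.391, (3.10)–(3.12) p.392, p.393, (3.69) p.404; Balaban1985RegularSpaces, Lemma 1 (1.25) p.79] -/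
theorem abs_re_inner_DeltaEta_sub_conj_le' {ε₀ : ℝ} (hε₀ : 0 ≤ ε₀) (σ : GaugeTransf (F.P K) 0 (Matrix.specialUnitaryGroup (Fin 2) ℂ))
    (U₀ W : GaugeField (F.P K) 0 (Matrix.specialUnitaryGroup (Fin 2) ℂ)) (hregU : RegPr F n K ε₀ U₀) (hregW : RegPr F n K ε₀ W)
    (X : PBond (F.P K) 0 → Matrix (Fin 2) (Fin 2) ℂ) {δ θ : ℝ} (hθ : 0 < θ)
    (hVW : ∀ (x : Site (F.P K) 0) (μ ν : Fin (F.P K).d), μ ≠ ν → X ⟨x.shift μ, ν⟩ ≠ 0 →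
      ‖((GaugeField.gaugeAct σ U₀ ⟨x, μ⟩ : Matrix.specialUnitaryGroup (Fin 2) ℂ) : Matrix (Fin 2) (Fin 2) ℂ) - (W ⟨x, μ⟩ : Matrix (Fin 2) (Fin 2) ℂ)‖ ≤ δ) :
    |RCLike.re ⟪toL2 F K c₀ X, DeltaEta F n K c₀ U₀ (toL2 F K c₀ X)⟫_ℂ
        - RCLike.re ⟪toL2 F K c₀ (fun b => (σ b.src : Matrix (Fin 2) (Fin 2) ℂ) * X b * star (σ b.src : Matrix (Fin 2) (Fin 2) ℂ)),
            DeltaEta F n K c₀ W (toL2 F K c₀ (fun b => (σ b.src : Matrix (Fin 2) (Fin 2) ℂ) * X b * star (σ b.src : Matrix (Fin 2) (Fin 2) ℂ)))⟫_ℂ|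
      ≤ θ * RCLike.re ⟪toL2 F K c₀ X, DeltaEta F n K c₀ U₀ (toL2 F K c₀ X)⟫_ℂ
        + (1 + θ⁻¹) * (16 * ((eta F n K)⁻¹) ^ 2 * δ ^ 2) * ‖toL2 F K c₀ X‖ ^ 2 + (2 + θ) * (1029 * ε₀) * ‖toL2 F K c₀ X‖ ^ 2 := by
  have hc₀ : 0 < c₀ := Fact.out
  have hη : 0 < eta F n K := eta_pos F n K
  have hk : 0 ≤ c₀ * (eta F n K)⁻¹ ^ 2 := by positivity
  set Y : PBond (F.P K) 0 → Matrix (Fin 2) (Fin 2) ℂ := fun b => (σ b.src : Matrix (Fin 2) (Fin 2) ℂ) * X b * star (σ b.src : Matrix (Fin 2) (Fin 2) ℂ) with hY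
  set V : GaugeField (F.P K) 0 (Matrix.specialUnitaryGroup (Fin 2) ℂ) := GaugeField.gaugeAct σ U₀ with hVdef
  set u : Site (F.P K) 0 × Fin (F.P K).d × Fin (F.P K).d → W₂ := fun q =>
      frobEquiv.symm (curl (torusT (F.P K) 0) (fun μ x => bgUnits F K V ⟨x, μ⟩) (formComp Y) q.2.1 q.2.2 q.1) with hu
  set w : Site (F.P K) 0 × Fin (F.P K).d × Fin (F.P K).d → W₂ := fun q =>
      frobEquiv.symm (curl (torusT (F.P K) 0) (fun μ x => bgUnits F K W ⟨x, μ⟩) (formComp Y) q.2.1 q.2.2 q.1) with hw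
  set PU : ℝ := (∑ b : PBond (F.P K) 0, Matrix.trace ((X b).conjTranspose
        * deltaPrimeOp (torusT (F.P K) 0) (fun μ x => bgUnits F K U₀ ⟨x, μ⟩) 1 (formComp X) b.dir b.src)).re with hPU
  set PW : ℝ := (∑ b : PBond (F.P K) 0, Matrix.trace ((Y b).conjTranspose
        * deltaPrimeOp (torusT (F.P K) 0) (fun μ x => bgUnits F K W ⟨x, μ⟩) 1 (formComp Y) b.dir b.src)).re with hPW
  set SX : ℝ := ∑ b : PBond (F.P K) 0, ‖(frobEquiv.symm (X b) : W₂)‖ ^ 2 with hSX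
  have hL : RCLike.re ⟪toL2 F K c₀ X, DeltaEta F n K c₀ U₀ (toL2 F K c₀ X)⟫_ℂ
      = c₀ * (eta F n K)⁻¹ ^ 2 * ((∑ q ∈ posPlaq (Site (F.P K) 0) (Fin (F.P K).d), ‖u q‖ ^ 2) + PU) := by
    rw [re_inner_DeltaEta_toL2_eq_curlSq_add U₀ X, ← curlSq_gaugeAct_conj_eq σ U₀ X]
  have hR : RCLike.re ⟪toL2 F K c₀ Y, DeltaEta F n K c₀ W (toL2 F K c₀ Y)⟫_ℂ
      = c₀ * (eta F n K)⁻¹ ^ 2 * ((∑ q ∈ posPlaq (Site (F.P K) 0) (Fin (F.P K).d), ‖w q‖ ^ 2) + PW) :=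
    re_inner_DeltaEta_toL2_eq_curlSq_add W Y
  have hSY : ∑ b : PBond (F.P K) 0, ‖(frobEquiv.symm (Y b) : W₂)‖ ^ 2 = SX := by
    rw [hSX, sum_norm_sq_frobEquiv_symm_eq, sum_norm_sq_frobEquiv_symm_eq]
    exact Finset.sum_congr rfl fun b _ => sum_normSq_conj_eq (σ b.src) (X b)
  have hVY : ∀ (x : Site (F.P K) 0) (μ ν : Fin (F.P K).d), μ ≠ ν → Y ⟨x.shift μ, ν⟩ ≠ 0 →
      ‖(V ⟨x, μ⟩ : Matrix (Fin 2) (Fin 2) ℂ) - (W ⟨x, μ⟩ : Matrix (Fin 2) (Fin 2) ℂ)‖ ≤ δ := by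
    intro x μ ν hμν hYb
    refine hVW x μ ν hμν fun h0 => hYb ?_
    simp [hY, h0]
  have hclose : ∑ q ∈ posPlaq (Site (F.P K) 0) (Fin (F.P K).d), ‖u q - w q‖ ^ 2 ≤ 16 * δ ^ 2 * SX := by
    have h1 := curlSq_sub_curlSq_le V W Y hVY
    have h2 : ∑ b : PBond (F.P K) 0, ∑ j, ∑ k, ‖Y b j k‖ ^ 2 = SX := by
      rw [← sum_norm_sq_frobEquiv_symm_eq, hSY]
    rw [h2] at h1
    refine le_of_eq_of_le (Finset.sum_congr rfl fun q _ => ?_) h1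
    rw [hu, hw, ← map_sub]
  have hPU' : |PU| ≤ 1029 * (ε₀ * eta F n K ^ 2) * SX := abs_curvPart_le hε₀ U₀ hregU X
  have hPW' : |PW| ≤ 1029 * (ε₀ * eta F n K ^ 2) * SX := by
    have h := abs_curvPart_le hε₀ W hregW Y
    rwa [hSY] at h
  have hnorm : ‖toL2 F K c₀ X‖ ^ 2 = c₀ * SX := norm_toL2_sq X
  -- squares row summed, main term on the FIRST (`U₀`) family
  have hsq := abs_sum_sq_sub_sum_sq_le (posPlaq (Site (F.P K) 0) (Fin (F.P K).d)) w u hθ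
  have hθ' : 0 ≤ 1 + θ⁻¹ := by positivity
  have hSX0 : 0 ≤ SX := Finset.sum_nonneg fun b _ => sq_nonneg _
  have hηη : (eta F n K)⁻¹ ^ 2 * eta F n K ^ 2 = 1 := by rw [← mul_pow, inv_mul_cancel₀ hη.ne', one_pow]
  rw [hL, hR, hnorm]
  set CU : ℝ := ∑ q ∈ posPlaq (Site (F.P K) 0) (Fin (F.P K).d), ‖u q‖ ^ 2 with hCU
  set CW : ℝ := ∑ q ∈ posPlaq (Site (F.P K) 0) (Fin (F.P K).d), ‖w q‖ ^ 2 with hCW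
  set k : ℝ := c₀ * (eta F n K)⁻¹ ^ 2 with hkdef
  have hclose' : ∑ q ∈ posPlaq (Site (F.P K) 0) (Fin (F.P K).d), ‖w q - u q‖ ^ 2 ≤ 16 * δ ^ 2 * SX := by
    refine le_of_eq_of_le (Finset.sum_congr rfl fun q _ => ?_) hclose
    rw [norm_sub_rev]
  have hmain : |CU - CW| ≤ θ * CU + (1 + θ⁻¹) * (16 * δ ^ 2 * SX) := by
    rw [abs_sub_comm]
    exact hsq.trans (add_le_add_right (mul_le_mul_of_nonneg_left hclose' hθ') _)
  have hPUk : k * |PU| ≤ 1029 * ε₀ * (c₀ * SX) := by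
    calc k * |PU| ≤ k * (1029 * (ε₀ * eta F n K ^ 2) * SX) := mul_le_mul_of_nonneg_left hPU' hk
      _ = 1029 * ε₀ * (c₀ * SX) * ((eta F n K)⁻¹ ^ 2 * eta F n K ^ 2) := by rw [hkdef]; ring
      _ = 1029 * ε₀ * (c₀ * SX) := by rw [hηη, mul_one]
  have hPWk : k * |PW| ≤ 1029 * ε₀ * (c₀ * SX) := by
    calc k * |PW| ≤ k * (1029 * (ε₀ * eta F n K ^ 2) * SX) := mul_le_mul_of_nonneg_left hPW' hk
      _ = 1029 * ε₀ * (c₀ * SX) * ((eta F n K)⁻¹ ^ 2 * eta F n K ^ 2) := by rw [hkdef]; ring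
      _ = 1029 * ε₀ * (c₀ * SX) := by rw [hηη, mul_one]
  have hkδ : k * ((1 + θ⁻¹) * (16 * δ ^ 2 * SX)) = (1 + θ⁻¹) * (16 * (eta F n K)⁻¹ ^ 2 * δ ^ 2) * (c₀ * SX) := by rw [hkdef]; ring
  have hCUle : k * CU ≤ k * (CU + PU) + k * |PU| := by
    have : -PU ≤ |PU| := neg_le_abs PU
    nlinarith [hk, this]
  calc |k * (CU + PU) - k * (CW + PW)|
        = k * |(CU - CW) + (PU - PW)| := by
          rw [← abs_of_nonneg hk, ← abs_mul, abs_of_nonneg hk]; ring_nf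
    _ ≤ k * (|CU - CW| + (|PU| + |PW|)) := by
          refine mul_le_mul_of_nonneg_left ((abs_add_le _ _).trans (add_le_add_right (abs_sub _ _) _)) hk
    _ ≤ k * ((θ * CU + (1 + θ⁻¹) * (16 * δ ^ 2 * SX)) + (|PU| + |PW|)) := by
          exact mul_le_mul_of_nonneg_left (add_le_add_left hmain _) hk
    _ = θ * (k * CU) + k * ((1 + θ⁻¹) * (16 * δ ^ 2 * SX)) + k * |PU| + k * |PW| := by ring
    _ ≤ θ * (k * (CU + PU) + k * |PU|) + (1 + θ⁻¹) * (16 * (eta F n K)⁻¹ ^ 2 * δ ^ 2) * (c₀ * SX)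
          + 1029 * ε₀ * (c₀ * SX) + 1029 * ε₀ * (c₀ * SX) := by
          rw [hkδ]
          have := mul_le_mul_of_nonneg_left hCUle hθ.le
          linarith
    _ ≤ θ * (k * (CU + PU)) + θ * (1029 * ε₀ * (c₀ * SX)) + (1 + θ⁻¹) * (16 * (eta F n K)⁻¹ ^ 2 * δ ^ 2) * (c₀ * SX)
          + 1029 * ε₀ * (c₀ * SX) + 1029 * ε₀ * (c₀ * SX) := by
          have := mul_le_mul_of_nonneg_left hPUk hθ.le
          linarith
    _ = θ * (k * (CU + PU)) + (1 + θ⁻¹) * (16 * (eta F n K)⁻¹ ^ 2 * δ ^ 2) * (c₀ * SX) + (2 + θ) * (1029 * ε₀) * (c₀ * SX) := by ring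

/-- ★★ **THE TWO-BACKGROUND (L5a) ROW, SUPPORT-FREE** (the small-member shape: one gauge `σ` on the whole torus, `‖U₀^σ(b) − W(b)‖ ≤ δ` on EVERY bond), main term at `W`, for every `X`.
[cite: Balaban1985BackgroundPropagators, (3.4) p.391, (3.10)–(3.12) p.392, p.393, (3.69) p.404] -/
theorem abs_re_inner_DeltaEta_sub_conj_le_of_forall {ε₀ : ℝ} (hε₀ : 0 ≤ ε₀) (σ : GaugeTransf (F.P K) 0 (Matrix.specialUnitaryGroup (Fin 2) ℂ))
    (U₀ W : GaugeField (F.P K) 0 (Matrix.specialUnitaryGroup (Fin 2) ℂ)) (hregU : RegPr F n K ε₀ U₀) (hregW : RegPr F n K ε₀ W) {δ θ : ℝ} (hθ : 0 < θ)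
    (hVW : ∀ b : PBond (F.P K) 0,
      ‖((GaugeField.gaugeAct σ U₀ b : Matrix.specialUnitaryGroup (Fin 2) ℂ) : Matrix (Fin 2) (Fin 2) ℂ) - (W b : Matrix (Fin 2) (Fin 2) ℂ)‖ ≤ δ)
    (X : PBond (F.P K) 0 → Matrix (Fin 2) (Fin 2) ℂ) :
    |RCLike.re ⟪toL2 F K c₀ X, DeltaEta F n K c₀ U₀ (toL2 F K c₀ X)⟫_ℂ
        - RCLike.re ⟪toL2 F K c₀ (fun b => (σ b.src : Matrix (Fin 2) (Fin 2) ℂ) * X b * star (σ b.src : Matrix (Fin 2) (Fin 2) ℂ)),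
            DeltaEta F n K c₀ W (toL2 F K c₀ (fun b => (σ b.src : Matrix (Fin 2) (Fin 2) ℂ) * X b * star (σ b.src : Matrix (Fin 2) (Fin 2) ℂ)))⟫_ℂ|
      ≤ θ * RCLike.re ⟪toL2 F K c₀ (fun b => (σ b.src : Matrix (Fin 2) (Fin 2) ℂ) * X b * star (σ b.src : Matrix (Fin 2) (Fin 2) ℂ)),
            DeltaEta F n K c₀ W (toL2 F K c₀ (fun b => (σ b.src : Matrix (Fin 2) (Fin 2) ℂ) * X b * star (σ b.src : Matrix (Fin 2) (Fin 2) ℂ)))⟫_ℂ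
        + (1 + θ⁻¹) * (16 * ((eta F n K)⁻¹) ^ 2 * δ ^ 2) * ‖toL2 F K c₀ X‖ ^ 2 + (2 + θ) * (1029 * ε₀) * ‖toL2 F K c₀ X‖ ^ 2 :=
  abs_re_inner_DeltaEta_sub_conj_le F n K c₀ hε₀ σ U₀ W hregU hregW X hθ fun x μ _ _ _ => hVW ⟨x, μ⟩

end Row

end Summit.QuantumFields.YangMills.Theorems.Prop7TwoBackgroundHessianComparison

end
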